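import Literature.Algebra.Polynomial.PseudoDivision
import Literature.AlgebraicGeometry.Motives.CurveThroughTwoPointsHypersurfaceModel

/-!
# LangWeilTransfer, support item `TransferGlue` (stmt-ValiantsHypothesis-6379) — algebraic helpers

Route `LangWeilTransfer` of `ValiantsHypothesis`, support item `TransferGlue`
(`LangWeilBound → GoodReduction → TameResolution → TameTransfer`). This file supplies the one step of
the glue that is not a hypothesis (refuter audit g41-11 / grounder g14-14 on the item): the transfer
of the `ℚ̄`-pointwise implication "`Q(x) = 0 ⇒ F(x) = 0`" delivered by `TameResolution` to an
INTEGER polynomial identity `C (cQ^k) · F^N = Q · H` (`cQ` = the integer leading `U`-coefficient of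
`Q`), which survives reduction modulo every prime `p ∤ cQ`. Ingredients: Hilbert's Nullstellensatz
over `ℚ ⊂ ℚ̄` (Mathlib `MvPolynomial.vanishingIdeal_zeroLocus_eq_radical`), pseudo-division by `Q`
in `ℤ[T][U]` (tree `Literature.Algebra.Polynomial.PseudoDivision`), and a degree comparison in
`ℚ[T][U]`. Also: clearing denominators in `S(V/ρ)` (`exists_cleared`), and the leading-coefficient /
`U`-degree bookkeeping of `Q` modulo `p` used to feed `LangWeilBound` (`¬ Q₁ ∣ ρ̄`).
Honest framing: bookkeeping inside a dormant route whose cruxes are open; nothing here bears on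
VP ≠ VNP.
-/

noncomputable section

open MvPolynomial

-- the summit and the problem share the name `ValiantsHypothesis` (D-0017 single-conjunct layout)
set_option linter.dupNamespace false

namespace Summit.ValiantsHypothesis.ValiantsHypothesis.Theorems.LangWeilTransfer

/-! ### Clearing denominators in `S(V/ρ)` -/

/-- **Clearing denominators.** For `S ∈ ℤ[Y_1..Y_m]`, `V_j, ρ ∈ ℤ[X]` there are `D` and an integer
polynomial `P` with `P(x) = ρ(x)^D · S(V(x)/ρ(x))` at every point `x` of every field where
`ρ(x) ≠ 0`. -/
theorem exists_cleared {σ : Type*} {m : ℕ} (V : Fin m → MvPolynomial σ ℤ) (ρ : MvPolynomial σ ℤ)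
    (S : MvPolynomial (Fin m) ℤ) :
    ∃ (D : ℕ) (P : MvPolynomial σ ℤ), ∀ (A : Type) [Field A] (x : σ → A), aeval x ρ ≠ 0 →
      aeval x P = aeval x ρ ^ D * aeval (fun j => aeval x (V j) / aeval x ρ) S := by
  induction S using MvPolynomial.induction_on' with
  | monomial α c =>
    refine ⟨α.sum fun _ e => e, C c * α.prod fun j e => V j ^ e, fun A _ x hρ => ?_⟩
    rw [aeval_monomial, map_mul, aeval_C, Finsupp.prod, map_prod, Finsupp.prod, Finsupp.sum]
    simp only [map_pow, div_pow]
    rw [Finset.prod_div_distrib, Finset.prod_pow_eq_pow_sum]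
    field_simp
  | add p q hp hq =>
    obtain ⟨D₁, P₁, h₁⟩ := hp
    obtain ⟨D₂, P₂, h₂⟩ := hq
    refine ⟨D₁ + D₂, ρ ^ D₂ * P₁ + ρ ^ D₁ * P₂, fun A _ x hρ => ?_⟩
    rw [map_add, map_mul, map_mul, map_pow, map_pow, h₁ A x hρ, h₂ A x hρ, map_add]
    ring

/-! ### `finSuccEquiv` and base change -/

-- naturality of `finSuccEquiv` in the coefficient ring: the tree's
-- `Literature.AlgebraicGeometry.Motives.TwoPointPencil.finSuccEquiv_map`
open Literature.AlgebraicGeometry.Motives.TwoPointPencil (finSuccEquiv_map)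

/-- `finSuccEquiv.symm (C (C a)) = C a`. -/
theorem finSuccEquiv_symm_C_C {R : Type*} [CommSemiring R] (n : ℕ) (a : R) :
    (finSuccEquiv R n).symm (Polynomial.C (C a)) = C a := by
  have := RingHom.congr_fun (finSuccEquiv_comp_C_eq_C (R := R) n) a
  simpa using this

/-- **Leading `U`-coefficient and `U`-degree of `Q` after base change to a field `A` with
`cQ ≠ 0` in `A`.** -/
theorem natDegree_leadingCoeff_map {r : ℕ} {Q : MvPolynomial (Fin (r + 1)) ℤ} {cQ : ℤ}
    (hlc : (finSuccEquiv ℤ r Q).leadingCoeff = C cQ) {A : Type*} [CommRing A]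
    (hA : (cQ : A) ≠ 0) :
    (finSuccEquiv A r (MvPolynomial.map (Int.castRingHom A) Q)).natDegree =
        (finSuccEquiv ℤ r Q).natDegree ∧
      (finSuccEquiv A r (MvPolynomial.map (Int.castRingHom A) Q)).leadingCoeff = C (cQ : A) := by
  have hne : (MvPolynomial.map (Int.castRingHom A)) (finSuccEquiv ℤ r Q).leadingCoeff ≠ 0 := by
    rw [hlc, map_C, eq_intCast]
    exact fun h => hA (C_eq_zero.mp h)
  rw [finSuccEquiv_map]
  refine ⟨Polynomial.natDegree_map_of_leadingCoeff_ne_zero _ hne, ?_⟩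
  rw [Polynomial.leadingCoeff_map_of_leadingCoeff_ne_zero _ hne, hlc, map_C, eq_intCast]

/-- Over a field `A` with `cQ ≠ 0` in `A` and positive `U`-degree, the base change of `Q` is not a
unit (it has positive `U`-degree). -/
theorem not_isUnit_map {r : ℕ} {Q : MvPolynomial (Fin (r + 1)) ℤ} {cQ : ℤ}
    (hlc : (finSuccEquiv ℤ r Q).leadingCoeff = C cQ) (hdeg : 0 < (finSuccEquiv ℤ r Q).natDegree)
    {A : Type*} [Field A] (hA : (cQ : A) ≠ 0) :
    ¬ IsUnit (MvPolynomial.map (Int.castRingHom A) Q) := by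
  intro hu
  have h1 := (natDegree_leadingCoeff_map hlc hA).1
  have hu' : IsUnit (finSuccEquiv A r (MvPolynomial.map (Int.castRingHom A) Q)) := hu.map _
  rw [Polynomial.natDegree_eq_zero_of_isUnit hu'] at h1
  omega

/-! ### The Nullstellensatz transfer -/

/-- **Transfer of a `ℚ̄`-pointwise implication to an integer identity.** If `Q ∈ ℤ[X_0..X_r]` has
constant integer leading `X_0`-coefficient `cQ ≠ 0` and positive `X_0`-degree, and `F ∈ ℤ[X]`
vanishes at every `ℚ̄`-zero of `Q`, then `C (cQ^k) · F^N = Q · H` for some `N ≥ 1`, `k`, `H`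
(Nullstellensatz over `ℚ ⊂ ℚ̄` + pseudo-division by `Q` in `ℤ[X_1..X_r][X_0]` + degrees). -/
theorem exists_C_pow_mul_pow_eq_mul {r : ℕ} (Q F : MvPolynomial (Fin (r + 1)) ℤ) {cQ : ℤ}
    (hcQ : cQ ≠ 0) (hlc : (finSuccEquiv ℤ r Q).leadingCoeff = C cQ)
    (hdeg : 0 < (finSuccEquiv ℤ r Q).natDegree)
    (hvan : ∀ x : Fin (r + 1) → AlgebraicClosure ℚ, aeval x Q = 0 → aeval x F = 0) :
    ∃ (N k : ℕ) (H : MvPolynomial (Fin (r + 1)) ℤ), 0 < N ∧ C (cQ ^ k) * F ^ N = Q * H := by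
  classical
  set φ : MvPolynomial (Fin (r + 1)) ℤ →+* MvPolynomial (Fin (r + 1)) ℚ :=
    MvPolynomial.map (Int.castRingHom ℚ) with hφ
  -- Nullstellensatz over `ℚ ⊂ ℚ̄`
  have hrad : φ F ∈ (Ideal.span {φ Q}).radical := by
    rw [← MvPolynomial.vanishingIdeal_zeroLocus_eq_radical (K := AlgebraicClosure ℚ),
      MvPolynomial.mem_vanishingIdeal_iff]
    intro x hx
    rw [MvPolynomial.zeroLocus_span] at hx
    have hQ : aeval x (φ Q) = 0 := hx _ (Set.mem_singleton _)
    rw [hφ, ← algebraMap_int_eq, aeval_map_algebraMap] at hQ ⊢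
    exact hvan x hQ
  obtain ⟨N, hN⟩ := Ideal.mem_radical_iff.mp hrad
  have hdvdQ : φ Q ∣ φ F ^ (N + 1) := by
    rw [pow_succ]
    exact dvd_mul_of_dvd_left (Ideal.mem_span_singleton.mp hN) _
  -- pseudo-division over `ℤ[X_1..X_r][X_0]`
  set u := finSuccEquiv ℤ r (F ^ (N + 1)) with hu
  set v := finSuccEquiv ℤ r Q with hv
  have hpd := Literature.Algebra.Polynomial.PseudoDivision.pseudoDivision u v
  have hrem := Literature.Algebra.Polynomial.PseudoDivision.natDegree_pseudoRem_lt u hdeg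
  set k := u.natDegree + 1 - v.natDegree with hk
  set q := Literature.Algebra.Polynomial.PseudoDivision.pseudoQuot u v with hq
  set rem := Literature.Algebra.Polynomial.PseudoDivision.pseudoRem u v with hremdef
  rw [hlc, ← map_pow] at hpd
  -- base change to `ℚ`
  set ψ : MvPolynomial (Fin r) ℤ →+* MvPolynomial (Fin r) ℚ := MvPolynomial.map (Int.castRingHom ℚ)
    with hψ
  have hψinj : Function.Injective ψ := MvPolynomial.map_injective _ Int.cast_injective
  have hvq : finSuccEquiv ℚ r (φ Q) = Polynomial.map ψ v := finSuccEquiv_map _ _ _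
  have huq : finSuccEquiv ℚ r (φ F ^ (N + 1)) = Polynomial.map ψ u := by
    rw [← map_pow, hφ, finSuccEquiv_map]
  have hdvd' : Polynomial.map ψ v ∣ Polynomial.map ψ u := by
    rw [← hvq, ← huq]; exact map_dvd _ hdvdQ
  have hpd' : Polynomial.C (C ((cQ : ℚ) ^ k)) * Polynomial.map ψ u =
      Polynomial.map ψ q * Polynomial.map ψ v + Polynomial.map ψ rem := by
    have := congr_arg (Polynomial.map ψ) hpd
    simpa [Polynomial.map_mul, Polynomial.map_add, hψ, map_C] using this
  have hremdvd : Polynomial.map ψ v ∣ Polynomial.map ψ rem := by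
    have : Polynomial.map ψ rem =
        Polynomial.C (C ((cQ : ℚ) ^ k)) * Polynomial.map ψ u - Polynomial.map ψ q * Polynomial.map ψ v := by
      rw [hpd']; ring
    rw [this]
    exact dvd_sub (dvd_mul_of_dvd_right hdvd' _) (dvd_mul_left _ _)
  have hcQq : ((cQ : ℚ)) ≠ 0 := by exact_mod_cast hcQ
  have hvdeg : (Polynomial.map ψ v).natDegree = v.natDegree := by
    have := (natDegree_leadingCoeff_map (A := ℚ) hlc hcQq).1
    rwa [finSuccEquiv_map] at this
  have hrem0 : Polynomial.map ψ rem = 0 := by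
    refine Polynomial.eq_zero_of_dvd_of_natDegree_lt hremdvd ?_
    rw [hvdeg]
    exact (Polynomial.natDegree_map_le).trans_lt hrem
  have hrem0' : rem = 0 := Polynomial.map_injective ψ hψinj (by rw [hrem0, Polynomial.map_zero])
  rw [hrem0', add_zero] at hpd
  -- pull back along `finSuccEquiv`
  refine ⟨N + 1, k, (finSuccEquiv ℤ r).symm q, Nat.succ_pos _, ?_⟩
  have := congr_arg (finSuccEquiv ℤ r).symm hpd
  rw [map_mul, map_mul, hu, hv, AlgEquiv.symm_apply_apply, AlgEquiv.symm_apply_apply,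
    finSuccEquiv_symm_C_C] at this
  rw [this, mul_comm]

/-! ### `U`-degree bookkeeping modulo `p`: an absolutely irreducible factor of `Q̄` does not divide
`ρ̄` -/

/-- In `A[X_1..X_r]` (`A` a field) a divisor of a nonzero constant is a unit. -/
theorem isUnit_of_dvd_C {r : ℕ} {A : Type*} [Field A] {q : MvPolynomial (Fin r) A} {c : A}
    (hc : c ≠ 0) (h : q ∣ C c) : IsUnit q := by
  obtain ⟨l, hl⟩ := h
  have hq0 : q ≠ 0 := by
    rintro rfl
    rw [zero_mul] at hl
    exact hc (C_eq_zero.mp hl)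
  have hl0 : l ≠ 0 := by
    rintro rfl
    rw [mul_zero] at hl
    exact hc (C_eq_zero.mp hl)
  have hdeg : (q * l).totalDegree = 0 := by rw [← hl, totalDegree_C]
  rw [totalDegree_mul_of_isDomain hq0 hl0] at hdeg
  have hq : q.totalDegree = 0 := by omega
  rw [totalDegree_eq_zero_iff_eq_C] at hq
  rw [hq]
  refine (isUnit_iff_ne_zero.mpr ?_).map C
  intro h0
  apply hq0
  rw [hq, h0, C_0]

/-- **`¬ Q₁ ∣ ρ̄`.** Let `A` be a field with `cQ ≠ 0` in `A`, `Q̄` the base change of `Q`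
(leading `X_0`-coefficient `cQ`), `Q₁` a non-unit divisor of `Q̄`, and `G ≠ 0` of `X_0`-degree `0`
(`finSuccEquiv G = C g`). Then `Q₁ ∤ G`. -/
theorem not_dvd_of_dvd_map {r : ℕ} {Q : MvPolynomial (Fin (r + 1)) ℤ} {cQ : ℤ}
    (hlc : (finSuccEquiv ℤ r Q).leadingCoeff = C cQ) {A : Type*} [Field A] (hA : (cQ : A) ≠ 0)
    {Q₁ G : MvPolynomial (Fin (r + 1)) A} (hQ₁ : ¬ IsUnit Q₁)
    (hdvd : Q₁ ∣ MvPolynomial.map (Int.castRingHom A) Q) {g : MvPolynomial (Fin r) A} (hg : g ≠ 0)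
    (hG : finSuccEquiv A r G = Polynomial.C g) : ¬ Q₁ ∣ G := by
  classical
  intro hG₁
  obtain ⟨H, hH⟩ := hdvd
  obtain ⟨M, hM⟩ := hG₁
  have hlcA := (natDegree_leadingCoeff_map hlc hA).2
  set vA := finSuccEquiv A r (MvPolynomial.map (Int.castRingHom A) Q) with hvA
  set v₁ := finSuccEquiv A r Q₁ with hv₁
  have hvA' : vA = v₁ * finSuccEquiv A r H := by rw [hvA, hH, map_mul]
  have hGA : Polynomial.C g = v₁ * finSuccEquiv A r M := by rw [← hG, hM, map_mul]
  have hv₁0 : v₁ ≠ 0 := by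
    intro h0; rw [h0, zero_mul] at hGA; exact hg (by simpa using hGA)
  have hM0 : finSuccEquiv A r M ≠ 0 := by
    intro h0; rw [h0, mul_zero] at hGA; exact hg (by simpa using hGA)
  have hdeg0 : v₁.natDegree = 0 := by
    have := congr_arg Polynomial.natDegree hGA
    rw [Polynomial.natDegree_C, Polynomial.natDegree_mul hv₁0 hM0] at this
    omega
  obtain ⟨q₁, hq₁⟩ : ∃ q₁, v₁ = Polynomial.C q₁ := ⟨_, Polynomial.eq_C_of_natDegree_eq_zero hdeg0⟩
  -- the leading coefficient of `vA` is `q₁ · lc(Ĥ) = C cQ`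
  have hlead : vA.leadingCoeff = q₁ * (finSuccEquiv A r H).leadingCoeff := by
    rw [hvA', hq₁, Polynomial.leadingCoeff_mul, Polynomial.leadingCoeff_C]
  rw [hlcA] at hlead
  have hunit : IsUnit q₁ := isUnit_of_dvd_C hA ⟨_, hlead⟩
  apply hQ₁
  have : Q₁ = (finSuccEquiv A r).symm (Polynomial.C q₁) := by
    rw [← hq₁, hv₁, AlgEquiv.symm_apply_apply]
  rw [this]
  exact (hunit.map Polynomial.C).map _

end Summit.ValiantsHypothesis.ValiantsHypothesis.Theorems.LangWeilTransfer
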